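import Mathlib
import Literature.Analysis.Calculus.ThirdMixedPartial
import HarnessLib

/-!
# Intertwining (Darboux) operators `∂ₓ − k ι` between the 1+1 wave equations with inverse-square
# potentials `(k−1)k ι²` and `k(k+1) ι²`

Analysis/PDE support file (everything proved, no definitions). On an open set `S` of the space
variable where the smooth coefficient `ι` satisfies the Riccati relation `ι' = −ι²` (e.g.
`ι = 1/(x − x₀)` on `x > x₀`), the first-order operator `a_k = ∂ₓ − k ι` maps `C³` solutions `φ` of

  `φ_tt = φ_xx − (k−1)k ι² φ`      (for `x ∈ S`)

to `C²` solutions `ψ = φ_x − k ι φ` of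

  `ψ_tt = ψ_xx − k(k+1) ι² ψ`      (for `x ∈ S`)

(`wave1D_intertwine`; both equations in the `iteratedDeriv 2` form of the tree's Regge–Wheeler items,
the potential entering as `+Vψ` after moving to the left). This is the classical factorisation
`−a_k† a_k = ∂² − k(k+1)/x²`, `−a_k a_k† = ∂² − (k−1)k/x²` (Infeld–Hull / Crum–Darboux; for the radial
wave equation it is the descent `u ↦ r⁻¹∂ᵣu` between odd dimensions, Kenig–Lawrie–Liu–Schlag 2015 §2).
Iterated `ℓ` times from the free equation (`k = 1, …, ℓ`) it produces the exact solutions of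
`ψ_tt − ψ_xx + ℓ(ℓ+1)x⁻²ψ = 0` from travelling waves — the far-side comparison dynamics of
`FixedModeChannels` (route PhotonSphereChannels, stmt-FinalStateConjecture-10048). The coefficient `ι`
is kept abstract and global (smooth on `ℝ`) so that all functions stay globally `C²`; the identity is
asserted only on `S`.
-/

noncomputable section

namespace Literature.Analysis.PDE

open Set Filter Topology Literature.Analysis.Calculus

/-- **Intertwining of inverse-square wave equations by `∂ₓ − kι`.** See the module docstring.
[folklore] -/
theorem wave1D_intertwine {φ : ℝ → ℝ → ℝ} {ι : ℝ → ℝ} (hφ : ContDiff ℝ 3 (Function.uncurry φ))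
    (hι : ContDiff ℝ 2 ι) (k : ℝ) {S : Set ℝ} (hS : IsOpen S)
    (hι' : ∀ x ∈ S, deriv ι x = -(ι x) ^ 2)
    (hsol : ∀ t, ∀ x ∈ S, iteratedDeriv 2 (fun τ => φ τ x) t
        = iteratedDeriv 2 (φ t) x - (k - 1) * k * ι x ^ 2 * φ t x) :
    ∃ ψ : ℝ → ℝ → ℝ, (∀ t x, ψ t x = deriv (φ t) x - k * ι x * φ t x) ∧
      ContDiff ℝ 2 (Function.uncurry ψ) ∧
      ∀ t, ∀ x ∈ S, iteratedDeriv 2 (fun τ => ψ τ x) t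
        = iteratedDeriv 2 (ψ t) x - k * (k + 1) * ι x ^ 2 * ψ t x := by
  obtain ⟨φx, hφxC2, hφx_d, hφx_eq, hxx3, httx⟩ := exists_partial_x_of_contDiff_three hφ
  set ψ : ℝ → ℝ → ℝ := fun t x => φx t x - k * ι x * φ t x with hψ
  have hφC2 : ContDiff ℝ 2 (Function.uncurry φ) := hφ.of_le (by norm_num)
  refine ⟨ψ, fun t x => by simp only [hψ, hφx_eq], ?_, fun t x hx => ?_⟩
  · -- `ψ` is `C²`
    show ContDiff ℝ 2 fun p : ℝ × ℝ => φx p.1 p.2 - k * ι p.2 * φ p.1 p.2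
    have h1 : ContDiff ℝ 2 fun p : ℝ × ℝ => φx p.1 p.2 := hφxC2
    have h2 : ContDiff ℝ 2 fun p : ℝ × ℝ => φ p.1 p.2 := hφC2
    have h3 : ContDiff ℝ 2 fun p : ℝ × ℝ => ι p.2 := hι.comp contDiff_snd
    exact h1.sub ((contDiff_const.mul h3).mul h2)
  · -- regularity of slices and of `ι`
    have hsl3 : ContDiff ℝ 3 (φ t) := hφ.comp (contDiff_const.prodMk contDiff_id)
    have hslt : ContDiff ℝ 2 fun τ => φ τ x := hφC2.comp (contDiff_id.prodMk contDiff_const)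
    have hslxt : ContDiff ℝ 2 fun τ => φx τ x := hφxC2.comp (contDiff_id.prodMk contDiff_const)
    have hslx2 : ContDiff ℝ 2 (φx t) := hφxC2.comp (contDiff_const.prodMk contDiff_id)
    have hιd : ∀ y, HasDerivAt ι (deriv ι y) y := fun y =>
      (hι.differentiable (by norm_num) y).hasDerivAt
    have hι1 : ContDiff ℝ 1 (deriv ι) := by
      have h2 : ContDiff ℝ ((1 : WithTop ℕ∞) + 1) ι := by
        rw [show ((1 : WithTop ℕ∞) + 1) = 2 by norm_num]; exact hι
      exact (contDiff_succ_iff_deriv.1 h2).2.2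
    have hι'd : HasDerivAt (deriv ι) (deriv (deriv ι) x) x :=
      (hι1.differentiable (by norm_num) x).hasDerivAt
    -- `ι'' = 2ι³` at `x` (from `ι' = −ι²` on the open set `S`)
    have hι'' : deriv (deriv ι) x = 2 * ι x ^ 3 := by
      have hev : deriv ι =ᶠ[𝓝 x] fun y => -ι y ^ 2 :=
        Filter.mem_of_superset (hS.mem_nhds hx) fun y hy => hι' y hy
      have h : HasDerivAt (fun y => -ι y ^ 2) (-(↑2 * ι x ^ (2 - 1) * deriv ι x)) x :=
        ((hιd x).pow 2).neg
      rw [hev.deriv_eq, h.deriv, hι' x hx]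
      norm_num
      ring
    -- (A) the `t`-side: `∂_t²ψ = ∂ₓ(∂_t²φ) − kι ∂_t²φ`, and `∂ₓ` of the equation
    have hA1 : iteratedDeriv 2 (fun τ => ψ τ x) t
        = iteratedDeriv 2 (fun τ => φx τ x) t - k * ι x * iteratedDeriv 2 (fun τ => φ τ x) t := by
      have hc : ContDiff ℝ 2 fun τ => k * ι x * φ τ x := contDiff_const.mul hslt
      show iteratedDeriv 2 (fun τ => φx τ x - k * ι x * φ τ x) t = _
      rw [iteratedDeriv_fun_sub (n := 2) hslxt.contDiffAt hc.contDiffAt, iteratedDeriv_const_mul_field]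
    have hA2 : iteratedDeriv 2 (fun τ => φx τ x) t = iteratedDeriv 3 (φ t) x
        - (k - 1) * k * (2 * ι x * deriv ι x * φ t x + ι x ^ 2 * φx t x) := by
      rw [httx]
      have hev : (fun y => iteratedDeriv 2 (fun τ => φ τ y) t)
          =ᶠ[𝓝 x] fun y => iteratedDeriv 2 (φ t) y - (k - 1) * k * ι y ^ 2 * φ t y :=
        Filter.mem_of_superset (hS.mem_nhds hx) fun y hy => hsol t y hy
      rw [hev.deriv_eq]
      have hd2 : HasDerivAt (iteratedDeriv 2 (φ t)) (iteratedDeriv 3 (φ t) x) x := by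
        have h := (hsl3.differentiable_iteratedDeriv 2 (by norm_num) x).hasDerivAt
        rwa [← iteratedDeriv_succ] at h
      have hrest : HasDerivAt (fun y => (k - 1) * k * ι y ^ 2 * φ t y)
          ((k - 1) * k * (↑2 * ι x ^ (2 - 1) * deriv ι x) * φ t x
            + (k - 1) * k * ι x ^ 2 * φx t x) x :=
        (((hιd x).pow 2).const_mul ((k - 1) * k)).mul (hφx_d t x)
      have h : HasDerivAt (fun y => iteratedDeriv 2 (φ t) y - (k - 1) * k * ι y ^ 2 * φ t y)
          (iteratedDeriv 3 (φ t) x - ((k - 1) * k * (↑2 * ι x ^ (2 - 1) * deriv ι x) * φ t x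
            + (k - 1) * k * ι x ^ 2 * φx t x)) x := hd2.sub hrest
      rw [h.deriv]
      norm_num
      ring
    -- (B) the `x`-side
    have hB1 : iteratedDeriv 2 (ψ t) x
        = iteratedDeriv 2 (φx t) x - k * iteratedDeriv 2 (fun y => ι y * φ t y) x := by
      have hψt : ψ t = fun y => φx t y - k * (ι y * φ t y) := by
        funext y; simp only [hψ]; ring
      have hc : ContDiff ℝ 2 fun y => k * (ι y * φ t y) :=
        contDiff_const.mul (hι.mul (hsl3.of_le (by norm_num)))
      rw [hψt, iteratedDeriv_fun_sub (n := 2) hslx2.contDiffAt hc.contDiffAt,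
        iteratedDeriv_const_mul_field]
    have hB2 : iteratedDeriv 2 (fun y => ι y * φ t y) x
        = deriv (deriv ι) x * φ t x + 2 * deriv ι x * φx t x + ι x * deriv (φx t) x := by
      rw [iteratedDeriv_succ, iteratedDeriv_one]
      have e1 : deriv (fun y => ι y * φ t y) = fun y => deriv ι y * φ t y + ι y * φx t y :=
        funext fun y => ((hιd y).mul (hφx_d t y)).deriv
      rw [e1]
      have hφxd' : HasDerivAt (φx t) (deriv (φx t) x) x :=
        (hslx2.differentiable (by norm_num) x).hasDerivAt
      have h1 : HasDerivAt (fun y => deriv ι y * φ t y)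
          (deriv (deriv ι) x * φ t x + deriv ι x * φx t x) x := hι'd.mul (hφx_d t x)
      have h2 : HasDerivAt (fun y => ι y * φx t y)
          (deriv ι x * φx t x + ι x * deriv (φx t) x) x := (hιd x).mul hφxd'
      have h : HasDerivAt (fun y => deriv ι y * φ t y + ι y * φx t y)
          (deriv (deriv ι) x * φ t x + deriv ι x * φx t x
            + (deriv ι x * φx t x + ι x * deriv (φx t) x)) x := h1.add h2
      rw [h.deriv]
      ring
    have hB3 : deriv (φx t) x = iteratedDeriv 2 (φ t) x := by
      rw [iteratedDeriv_succ, iteratedDeriv_one, hφx_eq]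
    -- combine with the equation at `x`
    have hsolx := hsol t x hx
    rw [hA1, hA2, hsolx, hB1, hB2, hB3, hxx3, hι'', hι' x hx]
    simp only [hψ]
    ring

end Literature.Analysis.PDE
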